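import Summits.CriticalPhenomena.PercolationContinuityZ3.Theorems.PercNearOneGluingNoHeavyLowerTailSahiE3ExchangeNestedTrace
import Mathlib.Tactic.Linarith
import Mathlib.Tactic.Ring
import Mathlib.Tactic.Positivity
import HarnessLib
import HarnessLib.Audit

/-!
# `NoHeavyLowerTail` (crux stmt-CriticalPhenomena-4575), Sahi programme P4: the 2×2 exchange lemma — reduction of the same-footprint "hats" packing to a trace-level scalar inequality

Support file (cell `prim-l12`, seat P4, generation 23; `--supports stmt-CriticalPhenomena-4575`).  No named facts, no sorries;
standard axioms; def-free.

Context (HOME prim-l12-p4/FROM-prim-l12-p4-gen23-*.md; predecessors `…SahiE3ExchangeCross`, `…SahiE3ExchangeSubpairs`,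
`…SahiE3ExchangeAntisym`).  For the 2×2 exchange expression of the OR-peel on a Harris block `(B,w,V)`,
  `Φ = X_a + R(KK'V) + R(LL'V) − need(K,L') − need(L,K') + (1−v)·Y`,
`X_a = w(PP'V) + w(OO'V) − w(P)w(O'V) − w(P')w(OV)`, `need(X,Y) = w(X)a(Y) + w(Y)a(X) − v·w(X)w(Y)`, `a = w(·∩V)`,
the SAME-FOOTPRINT packing uses the pair inequality at "hat" sets `HK ⊇ K`, `HK' ⊇ K'`, `HL ⊇ L`, `HL' ⊇ L'` with the same traces
(`HX ∩ V = X ∩ V`; canonical choice: the V-saturations) that are Harris-positive against the slot (`v·w(HX) ≤ w(HX ∩ V)`, true for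
up-sets under an FKG weight).  Writing `a_X = w(X∩V)` and `κ̂_X = a_X − v·w(HX) ≥ 0`, the identity
`v·need(X,Y) = a_X a_Y − κ_X κ_Y` (`κ_X = a_X − v·w(X) ≥ κ̂_X`) gives the R-free lower bound
  `v·[need(HK,HK') + need(HL,HL') − need(K,L') − need(L,K')] ≥ (a_K−a_L)(a_{K'}−a_{L'}) − (κ̂_K−κ̂_L)(κ̂_{K'}−κ̂_{L'})`
(`hats_scalar`), and `X_a ≥ w((P∖O)∩(P'∖O')∩V)` (modularity over nested differences plus the two Harris slacks of `X_a`).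
THEOREM `exchange_of_hats`: if `R` satisfies the pair inequality at `(HK,HK')` and `(HL,HL')` and the TRACE-LEVEL scalar
inequality
  `0 ≤ v·Z + (a_K−a_L)(a_{K'}−a_{L'}) − (κ̂_K−κ̂_L)(κ̂_{K'}−κ̂_{L'})`   for some `0 ≤ Z ≤ w((P∖O)∩(P'∖O')∩V)`
holds, then `Φ ≥ 0` for every bracket `Y ≥ 0`.  For the flagship block `x₀∧(x₁∨x₂)` the scalar inequality (with `Z` the
mass of the smallest trace set forced into `(P∖O)∩(P'∖O')∩V` by the configuration) is a polynomial inequality in the three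
coordinate probabilities that holds, pattern by pattern, for every crossing configuration whose four traces `K∩V, L∩V, K'∩V,
L'∩V` are nonempty (HOME memo: 308 patterns, 42 polynomials, all Bernstein-positive on the unit square) — so this lemma and the
landed crossing-free / empty-layer lemmas cover level `G' = ∅` of the flagship's OR-peel.
-/

namespace Summit.CriticalPhenomena.PercolationContinuityZ3.Theorems.SahiE3ExchangeHats

open Finset SahiE3DimerPacking SahiE3ExchangeCross SahiE3ExchangeNestedTrace
open scoped BigOperators

variable {B : Type*} [DecidableEq B]

/-- **Scalar core of the hats packing.**  Reals: `v ∈ [0,1]`; trace masses `aK, aL, aK', aL' ∈ [0,v]`; raw masses below hat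
masses (`k ≤ hK`, …) with `0 ≤ k, l, k', l'`; hats Harris-positive (`v·hX ≤ aX`); supplies `RK ≥ need(HK,HK')`,
`RL ≥ need(HL,HL')`; base `X ≥ Z ≥ 0`; bracket `Y ≥ 0`; and the trace-level inequality
`0 ≤ v·Z + (aK−aL)(aK'−aL') − (κ̂K−κ̂L)(κ̂K'−κ̂L')`, `κ̂X = aX − v·hX`.  Then
`0 ≤ X + RK + RL − need(K,L') − need(L,K') + (1−v)·Y`. [this work] -/
theorem hats_scalar (v aK aL aK' aL' k l k' l' hK hL hK' hL' X Z Y RK RL : ℝ)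
    (hv0 : 0 ≤ v) (hv1 : v ≤ 1)
    (haK0 : 0 ≤ aK) (haL0 : 0 ≤ aL) (haK'0 : 0 ≤ aK') (haL'0 : 0 ≤ aL')
    (haKv : aK ≤ v) (haLv : aL ≤ v) (haK'v : aK' ≤ v) (haL'v : aL' ≤ v)
    (hk : k ≤ hK) (hl : l ≤ hL) (hk' : k' ≤ hK') (hl' : l' ≤ hL')
    (hκK : v * hK ≤ aK) (hκL : v * hL ≤ aL) (hκK' : v * hK' ≤ aK') (hκL' : v * hL' ≤ aL')
    (hRK : hK * aK' + hK' * aK - v * hK * hK' ≤ RK) (hRL : hL * aL' + hL' * aL - v * hL * hL' ≤ RL)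
    (hZ0 : 0 ≤ Z) (hZX : Z ≤ X) (hY : 0 ≤ Y)
    (hS : 0 ≤ v * Z + (aK - aL) * (aK' - aL') - ((aK - v * hK) - (aL - v * hL)) * ((aK' - v * hK') - (aL' - v * hL'))) :
    0 ≤ X + RK + RL - (k * aL' + l' * aK - v * k * l') - (l * aK' + k' * aL - v * l * k') + (1 - v) * Y := by
  -- raw κ's dominate hat κ̂'s (both nonnegative)
  have e1 : (aK - v * hK) * (aL' - v * hL') ≤ (aK - v * k) * (aL' - v * l') := by
    have h1 : aK - v * hK ≤ aK - v * k := by nlinarith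
    have h2 : aL' - v * hL' ≤ aL' - v * l' := by nlinarith
    calc (aK - v * hK) * (aL' - v * hL') ≤ (aK - v * k) * (aL' - v * hL') :=
          mul_le_mul_of_nonneg_right h1 (by linarith)
      _ ≤ (aK - v * k) * (aL' - v * l') := mul_le_mul_of_nonneg_left h2 (by nlinarith)
  have e2 : (aL - v * hL) * (aK' - v * hK') ≤ (aL - v * l) * (aK' - v * k') := by
    have h1 : aL - v * hL ≤ aL - v * l := by nlinarith
    have h2 : aK' - v * hK' ≤ aK' - v * k' := by nlinarith
    calc (aL - v * hL) * (aK' - v * hK') ≤ (aL - v * l) * (aK' - v * hK') :=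
          mul_le_mul_of_nonneg_right h1 (by linarith)
      _ ≤ (aL - v * l) * (aK' - v * k') := mul_le_mul_of_nonneg_left h2 (by nlinarith)
  -- v·(supplies − needs) ≥ Π₁ − K̂H
  have core : (aK - aL) * (aK' - aL') - ((aK - v * hK) - (aL - v * hL)) * ((aK' - v * hK') - (aL' - v * hL'))
      ≤ v * (RK + RL - (k * aL' + l' * aK - v * k * l') - (l * aK' + k' * aL - v * l * k')) := by
    nlinarith [hRK, hRL, e1, e2]
  have hvY : 0 ≤ (1 - v) * Y := mul_nonneg (by linarith) hY
  rcases eq_or_lt_of_le hv0 with hv | hv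
  · -- v = 0: all trace masses vanish
    subst hv
    have h1 : aK = 0 := by linarith
    have h2 : aL = 0 := by linarith
    have h3 : aK' = 0 := by linarith
    have h4 : aL' = 0 := by linarith
    subst h1; subst h2; subst h3; subst h4
    ring_nf at hRK hRL ⊢
    linarith
  · have hZv := mul_le_mul_of_nonneg_left hZX hv0
    have hvY' : 0 ≤ v * ((1 - v) * Y) := mul_nonneg hv0 hvY
    have key : 0 ≤ v * (X + RK + RL - (k * aL' + l' * aK - v * k * l') - (l * aK' + k' * aL - v * l * k')) := by
      linarith [core, hS, hZv]
    have key2 : 0 ≤ X + RK + RL - (k * aL' + l' * aK - v * k * l') - (l * aK' + k' * aL - v * l * k') := by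
      by_contra hneg
      have hneg : X + RK + RL - (k * aL' + l' * aK - v * k * l') - (l * aK' + k' * aL - v * l * k') < 0 :=
        lt_of_not_ge hneg
      have : v * (X + RK + RL - (k * aL' + l' * aK - v * k * l') - (l * aK' + k' * aL - v * l * k')) < 0 :=
        mul_neg_of_pos_of_neg hv hneg
      linarith
    linarith

/-- **Base term.**  For `w ≥ 0` on `V` and nestings `O ⊆ P`, `O' ⊆ P'`:
`w(PP'V) + w(OO'V) ≥ w(PO'V) + w(OP'V) + w((P∖O)∩(P'∖O')∩V)` (pointwise identity
`(1_P − 1_O)(1_{P'} − 1_{O'}) = 1_{(P∖O)∩(P'∖O')}`). [folklore] -/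
theorem modularity_diff (w : B → ℝ) (V P O P' O' : Finset B) (hw : ∀ b ∈ V, 0 ≤ w b)
    (hOP : O ⊆ P) (hOP' : O' ⊆ P') :
    (∑ b ∈ (P ∩ O') ∩ V, w b) + (∑ b ∈ (O ∩ P') ∩ V, w b) + ∑ b ∈ ((P \ O) ∩ (P' \ O')) ∩ V, w b
      ≤ (∑ b ∈ (P ∩ P') ∩ V, w b) + ∑ b ∈ (O ∩ O') ∩ V, w b := by
  simp only [sum_inter_eq_sum_ite, ← Finset.sum_add_distrib]
  refine Finset.sum_le_sum fun b hb => ?_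
  have hwb := hw b hb
  by_cases hp : b ∈ P <;> by_cases ho : b ∈ O <;> by_cases hp' : b ∈ P' <;> by_cases ho' : b ∈ O' <;>
    simp only [hp, ho, hp', ho', Finset.mem_inter, Finset.mem_sdiff, and_true, and_false, and_self, not_true,
      not_false_eq_true, ↓reduceIte, add_zero, zero_add, le_refl] <;>
    first
      | exact absurd (hOP ho) hp
      | exact absurd (hOP' ho') hp'

/-- **The 2×2 exchange lemma from the hats packing and a trace-level inequality** (see the module docstring).  `B` finite,
`w ≥ 0` of total mass `1`, slot `V`; configuration `O ⊆ K, L ⊆ P`, `O' ⊆ K', L' ⊆ P'`; hat sets `HK ⊇ K`, `HL ⊇ L`, `HK' ⊇ K'`,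
`HL' ⊇ L'` with the same traces, Harris-positive against the slot; the pair inequality for `R` at `(HK,HK')` and `(HL,HL')`;
Harris for `(P, O'∩V)` and `(P', O∩V)`; a bracket `Y ≥ 0`; and the scalar hypothesis
`0 ≤ v·Z + (a_K−a_L)(a_{K'}−a_{L'}) − (κ̂_K−κ̂_L)(κ̂_{K'}−κ̂_{L'})` for some `0 ≤ Z ≤ w((P∖O)∩(P'∖O')∩V)`.  Then the exchange
expression with bracket `Y` is nonnegative. [this work] -/
theorem exchange_of_hats [Fintype B] (w R : B → ℝ) (hw : ∀ b, 0 ≤ w b) (hw1 : ∑ b, w b = 1)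
    (V K L P O K' L' P' O' HK HL HK' HL' : Finset B) (Y Z : ℝ)
    (hKP : K ⊆ P) (hOK : O ⊆ K) (hKP' : K' ⊆ P') (hOK' : O' ⊆ K')
    (hKH : K ⊆ HK) (hLH : L ⊆ HL) (hK'H : K' ⊆ HK') (hL'H : L' ⊆ HL')
    (hTK : HK ∩ V = K ∩ V) (hTL : HL ∩ V = L ∩ V) (hTK' : HK' ∩ V = K' ∩ V) (hTL' : HL' ∩ V = L' ∩ V)
    (hHK : (∑ b ∈ V, w b) * (∑ b ∈ HK, w b) ≤ ∑ b ∈ HK ∩ V, w b)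
    (hHL : (∑ b ∈ V, w b) * (∑ b ∈ HL, w b) ≤ ∑ b ∈ HL ∩ V, w b)
    (hHK' : (∑ b ∈ V, w b) * (∑ b ∈ HK', w b) ≤ ∑ b ∈ HK' ∩ V, w b)
    (hHL' : (∑ b ∈ V, w b) * (∑ b ∈ HL', w b) ≤ ∑ b ∈ HL' ∩ V, w b)
    (hpair₁ : (∑ b ∈ HK, w b) * (∑ b ∈ HK' ∩ V, w b) + (∑ b ∈ HK', w b) * (∑ b ∈ HK ∩ V, w b)
        - (∑ b ∈ V, w b) * (∑ b ∈ HK, w b) * (∑ b ∈ HK', w b) ≤ ∑ b ∈ (K ∩ K') ∩ V, R b)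
    (hpair₂ : (∑ b ∈ HL, w b) * (∑ b ∈ HL' ∩ V, w b) + (∑ b ∈ HL', w b) * (∑ b ∈ HL ∩ V, w b)
        - (∑ b ∈ V, w b) * (∑ b ∈ HL, w b) * (∑ b ∈ HL', w b) ≤ ∑ b ∈ (L ∩ L') ∩ V, R b)
    (hHar₁ : (∑ b ∈ P, w b) * (∑ b ∈ O' ∩ V, w b) ≤ ∑ b ∈ (P ∩ O') ∩ V, w b)
    (hHar₂ : (∑ b ∈ P', w b) * (∑ b ∈ O ∩ V, w b) ≤ ∑ b ∈ (O ∩ P') ∩ V, w b)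
    (hY : 0 ≤ Y) (hZ0 : 0 ≤ Z) (hZ : Z ≤ ∑ b ∈ ((P \ O) ∩ (P' \ O')) ∩ V, w b)
    (hS : 0 ≤ (∑ b ∈ V, w b) * Z
        + ((∑ b ∈ K ∩ V, w b) - ∑ b ∈ L ∩ V, w b) * ((∑ b ∈ K' ∩ V, w b) - ∑ b ∈ L' ∩ V, w b)
        - (((∑ b ∈ K ∩ V, w b) - (∑ b ∈ V, w b) * ∑ b ∈ HK, w b)
            - ((∑ b ∈ L ∩ V, w b) - (∑ b ∈ V, w b) * ∑ b ∈ HL, w b))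
          * (((∑ b ∈ K' ∩ V, w b) - (∑ b ∈ V, w b) * ∑ b ∈ HK', w b)
            - ((∑ b ∈ L' ∩ V, w b) - (∑ b ∈ V, w b) * ∑ b ∈ HL', w b))) :
    0 ≤ (∑ b ∈ (P ∩ P') ∩ V, w b) + (∑ b ∈ (O ∩ O') ∩ V, w b)
        - (∑ b ∈ P, w b) * (∑ b ∈ O' ∩ V, w b) - (∑ b ∈ P', w b) * (∑ b ∈ O ∩ V, w b)
        + (∑ b ∈ (K ∩ K') ∩ V, R b) + (∑ b ∈ (L ∩ L') ∩ V, R b)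
        - ((∑ b ∈ K, w b) * (∑ b ∈ L' ∩ V, w b) + (∑ b ∈ L', w b) * (∑ b ∈ K ∩ V, w b)
            - (∑ b ∈ V, w b) * (∑ b ∈ K, w b) * (∑ b ∈ L', w b))
        - ((∑ b ∈ L, w b) * (∑ b ∈ K' ∩ V, w b) + (∑ b ∈ K', w b) * (∑ b ∈ L ∩ V, w b)
            - (∑ b ∈ V, w b) * (∑ b ∈ L, w b) * (∑ b ∈ K', w b))
        + (1 - ∑ b ∈ V, w b) * Y := by
  have hwV : ∀ b ∈ V, 0 ≤ w b := fun b _ => hw b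
  have hmod := modularity_diff w V P O P' O' hwV (hOK.trans hKP) (hOK'.trans hKP')
  have hv1 : ∑ b ∈ V, w b ≤ 1 := by
    rw [← hw1]; exact sum_le_sum_of_subset' w hw (Finset.subset_univ V)
  have hv0 : 0 ≤ ∑ b ∈ V, w b := Finset.sum_nonneg fun b _ => hw b
  have hk : ∑ b ∈ K, w b ≤ ∑ b ∈ HK, w b := sum_le_sum_of_subset' w hw hKH
  have hl : ∑ b ∈ L, w b ≤ ∑ b ∈ HL, w b := sum_le_sum_of_subset' w hw hLH
  have hk' : ∑ b ∈ K', w b ≤ ∑ b ∈ HK', w b := sum_le_sum_of_subset' w hw hK'H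
  have hl' : ∑ b ∈ L', w b ≤ ∑ b ∈ HL', w b := sum_le_sum_of_subset' w hw hL'H
  have haK0 : 0 ≤ ∑ b ∈ K ∩ V, w b := Finset.sum_nonneg fun b _ => hw b
  have haL0 : 0 ≤ ∑ b ∈ L ∩ V, w b := Finset.sum_nonneg fun b _ => hw b
  have haK'0 : 0 ≤ ∑ b ∈ K' ∩ V, w b := Finset.sum_nonneg fun b _ => hw b
  have haL'0 : 0 ≤ ∑ b ∈ L' ∩ V, w b := Finset.sum_nonneg fun b _ => hw b
  have haKv : ∑ b ∈ K ∩ V, w b ≤ ∑ b ∈ V, w b := sum_le_sum_of_subset' w hw Finset.inter_subset_right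
  have haLv : ∑ b ∈ L ∩ V, w b ≤ ∑ b ∈ V, w b := sum_le_sum_of_subset' w hw Finset.inter_subset_right
  have haK'v : ∑ b ∈ K' ∩ V, w b ≤ ∑ b ∈ V, w b := sum_le_sum_of_subset' w hw Finset.inter_subset_right
  have haL'v : ∑ b ∈ L' ∩ V, w b ≤ ∑ b ∈ V, w b := sum_le_sum_of_subset' w hw Finset.inter_subset_right
  have hPi0 : 0 ≤ ∑ b ∈ ((P \ O) ∩ (P' \ O')) ∩ V, w b := Finset.sum_nonneg fun b _ => hw b
  rw [hTK, hTK'] at hpair₁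
  rw [hTL, hTL'] at hpair₂
  rw [hTK] at hHK
  rw [hTL] at hHL
  rw [hTK'] at hHK'
  rw [hTL'] at hHL'
  exact le_trans (hats_scalar (∑ b ∈ V, w b) (∑ b ∈ K ∩ V, w b) (∑ b ∈ L ∩ V, w b) (∑ b ∈ K' ∩ V, w b)
      (∑ b ∈ L' ∩ V, w b) (∑ b ∈ K, w b) (∑ b ∈ L, w b) (∑ b ∈ K', w b) (∑ b ∈ L', w b)
      (∑ b ∈ HK, w b) (∑ b ∈ HL, w b) (∑ b ∈ HK', w b) (∑ b ∈ HL', w b)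
      ((∑ b ∈ (P ∩ P') ∩ V, w b) + (∑ b ∈ (O ∩ O') ∩ V, w b)
        - (∑ b ∈ P, w b) * (∑ b ∈ O' ∩ V, w b) - (∑ b ∈ P', w b) * (∑ b ∈ O ∩ V, w b))
      Z Y (∑ b ∈ (K ∩ K') ∩ V, R b) (∑ b ∈ (L ∩ L') ∩ V, R b)
      hv0 hv1 haK0 haL0 haK'0 haL'0 haKv haLv haK'v haL'v hk hl hk' hl'
      hHK hHL hHK' hHL' hpair₁ hpair₂ hZ0 (by linarith) hY hS) (le_of_eq (by ring))

end Summit.CriticalPhenomena.PercolationContinuityZ3.Theorems.SahiE3ExchangeHats
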